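import Mathlib
import HarnessLib
import Summits.HubbardSuperconductivity.HubbardSuperconductivity.Theorems.KLProgrammeC4aAbsBubbleRelative

/-!
# Route `KLProgramme` — crux C4a, S3 brick (B4) «(B4)-UMK1», part 4: the LEVEL LAYER of the signed fold law — with the fold-value drift
# `δ₀ − λ₂e ≤ m(e) ≤ δ₀ − λ₁e` the per-level size `(1 + log⁺(G/e))·(A·M^{−3/2} + B·M^{−1})`, `M = max(e,|m(e)|)`, integrates to `O(|δ₀|^{−1/2}·log²)`, `lo`-FREE

Cell `gate-hubbard-kl`, seat hubbard-kl-k3c3-p3 (g27; row «implicit-function / monotonicity route for μ(n)»).  Located brick for the (C)-closer lane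
hubbard-kl-c4a-1 (stub (C) `stub_twoLeg_curvature` of `KLRegimeEngineV17F2`, stmt-HubbardSuperconductivity-20437), design note HOME/hubbard-kl-k3c3-p3/B4-UMK1-DESIGN.md
§4 (b′).  Part 3 (`…C4aFoldSignedLaw`) bounds the loop-angle integral of `X·K′(ē)` across a fold at the finer level `e` by `(1 + log⁺(G/t))·(A·M^{−3/2} + B·M^{−1})`,
`M = max(t,|ē_min(e)|)`, `t ≥ e`.  The fold value DRIFTS with the level: `ē_min(e) ∈ [δ₀ − λ₂e, δ₀ − λ₁e]` (`δ₀` = the configuration's caustic offset, `λ₁ ≤ λ₂` from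
`∂_eē ∈ [−λ₂, −λ₁]`, the external-tangency normal alignment) — no implicit function is needed, only monotonicity of the minimum.  Then:
* §1 **`profile_le_max_of_drift`**: `(|δ₀| + λ₁e)/(4 + 2λ₂ + λ₁) ≤ max(e, |m(e)|)` — the post-caustic crossing level `e ≈ δ₀/λ` costs nothing because `M ≥ e` there;
* §2 **`intervalIntegral_fold_first_order_layer_le`**: for `0 < lo ≤ hi`, weight `0 ≤ w ≤ W`, `0 ≤ I(e) ≤ (1 + log⁺(G/e))·(A·M^{−3/2} + B·M^{−1})`, `|δ₀| > 0`:
  `∫_{lo..hi} w·I ≤ W·((Q + 2R)·θ₀ + P·log⁺(hi/θ₀))` with `θ₀ = |δ₀|/λ₁`, `R = A(C/|δ₀|)/√(|δ₀|/C) + B·C/|δ₀|`, `Q = (1 + log⁺(2G/θ₀))·R`,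
  `P = (1 + log⁺(G/θ₀))·(A(C/λ₁)/√(|δ₀|/C) + B·C/λ₁)`, `C = 4 + 2λ₂ + λ₁` — every term is `O(|δ₀|^{−1/2}·log²)` or smaller and NONE depends on `lo`
  (`…C4aAbsBubbleRelative.intervalIntegral_level_layer_threshold_le` with `S = 0`).  The caustic itself (`δ₀ = 0`) is one tube angle; the ϑ-layer (next) integrates
  `|δ₀(ϑ)|^{−1/2}log²` across a transversal zero.
Pure real analysis.  References: Salmhofer 1999 §4.5.3 Lemma 4.10 [cite: Salmhofer1999]; FST II CPAM 51 (1998) §3 [cite: FeldmanSalmhoferTrubowitz1998].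
-/

noncomputable section

namespace Summit.HubbardSuperconductivity.HubbardSuperconductivity.Theorems.C4a

set_option linter.dupNamespace false -- summit = problem name (single-conjunct summit), D-0017

open Real Set MeasureTheory intervalIntegral

/-! ## §1 The drift profile -/

/-- **THE DRIFT PROFILE**: `0 ≤ e`, `0 < λ₁ ≤ λ₂`, `δ₀ − λ₂e ≤ m ≤ δ₀ − λ₁e` ⟹ `(|δ₀| + λ₁e)/(4 + 2λ₂ + λ₁) ≤ max(e,|m|)`. -/
theorem profile_le_max_of_drift {e δ₀ la₁ la₂ me : ℝ} (he : 0 ≤ e) (hla₁ : 0 < la₁) (hla₁₂ : la₁ ≤ la₂) (hlow : δ₀ - la₂ * e ≤ me)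
    (hup : me ≤ δ₀ - la₁ * e) : (|δ₀| + la₁ * e) / (4 + 2 * la₂ + la₁) ≤ max e |me| := by
  have hC : 0 < 4 + 2 * la₂ + la₁ := by linarith
  rw [div_le_iff₀ hC]
  rcases le_or_gt δ₀ 0 with hδ | hδ
  · -- `δ₀ ≤ 0`: `m ≤ δ₀ − λ₁e ≤ 0`, `|m| ≥ |δ₀| + λ₁e`
    have hm0 : me ≤ 0 := by nlinarith
    have h1 : |δ₀| + la₁ * e ≤ |me| := by rw [abs_of_nonpos hδ, abs_of_nonpos hm0]; linarith
    have h2 : |me| ≤ max e |me| := le_max_right _ _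
    have h3 : 0 ≤ |δ₀| + la₁ * e := by positivity
    nlinarith [le_max_right e |me|, abs_nonneg me]
  · rw [abs_of_pos hδ]
    rcases le_or_gt e (δ₀ / (2 * la₂)) with h | h
    · -- small levels: `m ≥ δ₀ − λ₂e ≥ δ₀/2`
      have hla₂ : 0 < la₂ := hla₁.trans_le hla₁₂
      have h1 : la₂ * e ≤ δ₀ / 2 := by
        have := mul_le_mul_of_nonneg_left h hla₂.le
        have e1 : la₂ * (δ₀ / (2 * la₂)) = δ₀ / 2 := by field_simp
        linarith [e1]
      have h2 : δ₀ / 2 ≤ |me| := by rw [abs_of_pos (by linarith)]; linarith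
      have h3 : la₁ * e ≤ δ₀ / 2 := by nlinarith
      nlinarith [le_max_right e |me|, hla₂]
    · -- large levels: `max ≥ e ≥ δ₀/(2λ₂)`
      have hla₂ : 0 < la₂ := hla₁.trans_le hla₁₂
      have h1 : δ₀ < 2 * la₂ * e := by
        have := (div_lt_iff₀ (by positivity : (0 : ℝ) < 2 * la₂)).1 h; linarith
      nlinarith [le_max_left e |me|, abs_nonneg me]

/-! ## §2 The level layer -/

/-- **THE LEVEL LAYER OF THE SIGNED FOLD LAW** (`lo`-free, `O(|δ₀|^{−1/2}·log²)`). -/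
theorem intervalIntegral_fold_first_order_layer_le {lo hi W A B G δ₀ la₁ la₂ : ℝ} {w I m : ℝ → ℝ} (hlo : 0 < lo) (hlohi : lo ≤ hi) (hW : 0 ≤ W)
    (hA : 0 ≤ A) (hB : 0 ≤ B) (hG : 0 < G) (hla₁ : 0 < la₁) (hla₁₂ : la₁ ≤ la₂) (hδ₀ : 0 < |δ₀|)
    (hdrift : ∀ e ∈ Icc lo hi, δ₀ - la₂ * e ≤ m e ∧ m e ≤ δ₀ - la₁ * e)
    (hw0 : ∀ e ∈ Icc lo hi, 0 ≤ w e) (hw : ∀ e ∈ Icc lo hi, w e ≤ W) (hI0 : ∀ e ∈ Icc lo hi, 0 ≤ I e)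
    (hI : ∀ e ∈ Icc lo hi, I e ≤ (1 + log⁺ (G / e)) * (A * ((max e |m e|)⁻¹ * (Real.sqrt (max e |m e|))⁻¹) + B * (max e |m e|)⁻¹)) :
    ∫ e in lo..hi, w e * I e ≤
      W * (((1 + log⁺ (2 * G / (|δ₀| / la₁))) *
              (A * ((4 + 2 * la₂ + la₁) / |δ₀|) * (Real.sqrt (|δ₀| / (4 + 2 * la₂ + la₁)))⁻¹ + B * ((4 + 2 * la₂ + la₁) / |δ₀|)) +
            2 * (A * ((4 + 2 * la₂ + la₁) / |δ₀|) * (Real.sqrt (|δ₀| / (4 + 2 * la₂ + la₁)))⁻¹ + B * ((4 + 2 * la₂ + la₁) / |δ₀|))) *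
          (|δ₀| / la₁) +
        (1 + log⁺ (G / (|δ₀| / la₁))) *
            (A * ((4 + 2 * la₂ + la₁) / la₁) * (Real.sqrt (|δ₀| / (4 + 2 * la₂ + la₁)))⁻¹ + B * ((4 + 2 * la₂ + la₁) / la₁)) *
          log⁺ (hi / (|δ₀| / la₁))) := by
  obtain ⟨C, hC⟩ : ∃ C : ℝ, C = 4 + 2 * la₂ + la₁ := ⟨_, rfl⟩
  obtain ⟨d, hd⟩ : ∃ d : ℝ, d = |δ₀| := ⟨_, rfl⟩
  have hCpos : 0 < C := by rw [hC]; linarith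
  have hdpos : 0 < d := by rw [hd]; exact hδ₀
  obtain ⟨θ₀, hθ₀⟩ : ∃ θ₀ : ℝ, θ₀ = d / la₁ := ⟨_, rfl⟩
  have hθ₀pos : 0 < θ₀ := by rw [hθ₀]; positivity
  obtain ⟨Zs, hZs⟩ : ∃ Zs : ℝ, Zs = (Real.sqrt (d / C))⁻¹ := ⟨_, rfl⟩
  have hZspos : 0 < Zs := by rw [hZs]; exact inv_pos.2 (Real.sqrt_pos.2 (by positivity))
  rw [← hC, ← hd, ← hθ₀, ← hZs]
  have hposlog : ∀ y : ℝ, 0 ≤ log⁺ y := fun _ => Real.posLog_nonneg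
  -- the profile at every level
  have hP : ∀ e ∈ Icc lo hi, (d + la₁ * e) / C ≤ max e |m e| := fun e he => by
    rw [hC, hd]; exact profile_le_max_of_drift (hlo.le.trans he.1) hla₁ hla₁₂ (hdrift e he).1 (hdrift e he).2
  have hPpos : ∀ e ∈ Icc lo hi, 0 < (d + la₁ * e) / C := fun e he => by
    have : 0 < e := hlo.trans_le he.1
    positivity
  -- monotone consequences: `M⁻¹ ≤ P⁻¹`, `(√M)⁻¹ ≤ (√P)⁻¹`
  have hinv : ∀ e ∈ Icc lo hi, (max e |m e|)⁻¹ ≤ ((d + la₁ * e) / C)⁻¹ := fun e he => inv_anti₀ (hPpos e he) (hP e he)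
  have hsinv : ∀ e ∈ Icc lo hi, (Real.sqrt (max e |m e|))⁻¹ ≤ (Real.sqrt ((d + la₁ * e) / C))⁻¹ := fun e he =>
    inv_anti₀ (Real.sqrt_pos.2 (hPpos e he)) (Real.sqrt_le_sqrt (hP e he))
  -- the √ factor is uniformly `≤ Zs`
  have hsZ : ∀ e ∈ Icc lo hi, (Real.sqrt ((d + la₁ * e) / C))⁻¹ ≤ Zs := fun e he => by
    rw [hZs]
    refine inv_anti₀ (Real.sqrt_pos.2 (by positivity)) (Real.sqrt_le_sqrt (div_le_div_of_nonneg_right ?_ hCpos.le))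
    have : 0 ≤ la₁ * e := mul_nonneg hla₁.le (hlo.le.trans he.1)
    linarith
  refine intervalIntegral_level_layer_threshold_le hlo hlohi (I := I) (w := w) (θ₀ := θ₀) (S := 0)
    (P := (1 + log⁺ (G / θ₀)) * (A * (C / la₁) * Zs + B * (C / la₁)))
    (Q := (1 + log⁺ (2 * G / θ₀)) * (A * (C / d) * Zs + B * (C / d))) (R := A * (C / d) * Zs + B * (C / d))
    hθ₀pos hW ?_ ?_ (by positivity) le_rfl hw0 hw hI0 ?_ ?_ |>.trans (le_of_eq (by ring))
  · have := hposlog (G / θ₀); positivity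
  · have := hposlog (2 * G / θ₀); positivity
  · -- small levels `e ≤ θ₀`: `P(e) ≥ d/C`
    intro e he heθ
    have he0 : 0 < e := hlo.trans_le he.1
    have hPe : d / C ≤ (d + la₁ * e) / C := div_le_div_of_nonneg_right (by nlinarith [hla₁.le, he0.le]) hCpos.le
    have h1 : (max e |m e|)⁻¹ ≤ C / d := by
      refine (hinv e he).trans ((inv_anti₀ (by positivity) hPe).trans (le_of_eq ?_))
      rw [inv_div]
    have h2 : (max e |m e|)⁻¹ * (Real.sqrt (max e |m e|))⁻¹ ≤ C / d * Zs :=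
      mul_le_mul h1 ((hsinv e he).trans (hsZ e he)) (inv_nonneg.2 (Real.sqrt_nonneg _)) (by positivity)
    have hlog : 1 + log⁺ (G / e) ≤ (1 + log⁺ (2 * G / θ₀)) + log⁺ (θ₀ / (2 * e)) := by
      have e1 : G / e = 2 * G / θ₀ * (θ₀ / (2 * e)) := by field_simp
      rw [e1]; linarith [Real.posLog_mul (x := 2 * G / θ₀) (y := θ₀ / (2 * e))]
    have hZ : A * ((max e |m e|)⁻¹ * (Real.sqrt (max e |m e|))⁻¹) + B * (max e |m e|)⁻¹ ≤ A * (C / d) * Zs + B * (C / d) := by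
      have := mul_le_mul_of_nonneg_left h2 hA
      have := mul_le_mul_of_nonneg_left h1 hB
      linarith
    have hZ0 : 0 ≤ A * ((max e |m e|)⁻¹ * (Real.sqrt (max e |m e|))⁻¹) + B * (max e |m e|)⁻¹ := by
      have : 0 ≤ (max e |m e|)⁻¹ := inv_nonneg.2 (le_max_of_le_left he0.le)
      have : 0 ≤ (Real.sqrt (max e |m e|))⁻¹ := inv_nonneg.2 (Real.sqrt_nonneg _)
      positivity
    calc I e ≤ (1 + log⁺ (G / e)) * (A * ((max e |m e|)⁻¹ * (Real.sqrt (max e |m e|))⁻¹) + B * (max e |m e|)⁻¹) := hI e he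
      _ ≤ ((1 + log⁺ (2 * G / θ₀)) + log⁺ (θ₀ / (2 * e))) * (A * (C / d) * Zs + B * (C / d)) :=
          mul_le_mul hlog hZ hZ0 (by have := hposlog (2 * G / θ₀); have := hposlog (θ₀ / (2 * e)); positivity)
      _ = (1 + log⁺ (2 * G / θ₀)) * (A * (C / d) * Zs + B * (C / d)) + (A * (C / d) * Zs + B * (C / d)) * log⁺ (θ₀ / (2 * e)) +
            0 * (Real.sqrt e)⁻¹ := by ring
  · -- large levels `θ₀ < e`: `P(e) ≥ λ₁e/C`, `e^{−1/2} ≤ θ₀^{−1/2}`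
    intro e he heθ
    have he0 : 0 < e := hlo.trans_le he.1
    have hPe : la₁ * e / C ≤ (d + la₁ * e) / C := div_le_div_of_nonneg_right (by linarith) hCpos.le
    have h1 : (max e |m e|)⁻¹ ≤ C / la₁ / e := by
      refine (hinv e he).trans ((inv_anti₀ (by positivity) hPe).trans (le_of_eq ?_))
      rw [inv_div]; field_simp
    have h2 : (max e |m e|)⁻¹ * (Real.sqrt (max e |m e|))⁻¹ ≤ C / la₁ / e * Zs :=
      mul_le_mul h1 ((hsinv e he).trans (hsZ e he)) (inv_nonneg.2 (Real.sqrt_nonneg _)) (by positivity)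
    have hlog : 1 + log⁺ (G / e) ≤ 1 + log⁺ (G / θ₀) := by
      have := Real.posLog_le_posLog (x := G / e) (y := G / θ₀) (by positivity) (div_le_div_of_nonneg_left hG.le hθ₀pos heθ.le)
      linarith
    have hZ : A * ((max e |m e|)⁻¹ * (Real.sqrt (max e |m e|))⁻¹) + B * (max e |m e|)⁻¹ ≤ (A * (C / la₁) * Zs + B * (C / la₁)) / e := by
      have := mul_le_mul_of_nonneg_left h2 hA
      have := mul_le_mul_of_nonneg_left h1 hB
      have e1 : (A * (C / la₁) * Zs + B * (C / la₁)) / e = A * (C / la₁ / e * Zs) + B * (C / la₁ / e) := by field_simp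
      rw [e1]; linarith
    have hZ0 : 0 ≤ A * ((max e |m e|)⁻¹ * (Real.sqrt (max e |m e|))⁻¹) + B * (max e |m e|)⁻¹ := by
      have : 0 ≤ (max e |m e|)⁻¹ := inv_nonneg.2 (le_max_of_le_left he0.le)
      have : 0 ≤ (Real.sqrt (max e |m e|))⁻¹ := inv_nonneg.2 (Real.sqrt_nonneg _)
      positivity
    calc I e ≤ (1 + log⁺ (G / e)) * (A * ((max e |m e|)⁻¹ * (Real.sqrt (max e |m e|))⁻¹) + B * (max e |m e|)⁻¹) := hI e he
      _ ≤ (1 + log⁺ (G / θ₀)) * ((A * (C / la₁) * Zs + B * (C / la₁)) / e) :=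
          mul_le_mul hlog hZ hZ0 (by have := hposlog (G / θ₀); positivity)
      _ = (1 + log⁺ (G / θ₀)) * (A * (C / la₁) * Zs + B * (C / la₁)) / e := by ring

end Summit.HubbardSuperconductivity.HubbardSuperconductivity.Theorems.C4a

end
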